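import Summits.CriticalPhenomena.PercolationContinuityZ3.Theorems.PercNearOneGluingNoHeavyLowerTailTwoPartitionHole
import Summits.CriticalPhenomena.PercolationContinuityZ3.Theorems.PercNearOneGluingNoHeavyLowerTailTwoPartitionPeelable
import HarnessLib.Audit

/-!
# `NoHeavyLowerTail` (crux stmt-CriticalPhenomena-4575), P3 gen 30: `ThreeSetAntipodal` for every up-set with AT MOST TWO COMPLEMENTARY PAIRS
Support file (`--supports stmt-CriticalPhenomena-4575`; memo `run/shared/lean/prim/prim-masterthm/FROM-prim-masterthm-p3-g30-SPLIT-AND-PEELING.md` §3,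
HIERARCHY §37).  Companion of `…TwoPartitionOnePair` (`|F| ≤ 2`) and `…TwoPartitionHole` (hole lemma, Kleitman split with a rung, pull-backs).
`threeSetN_nonneg_of_card_inter_compls_le_four`: `#(𝒜 ∩ 𝒜ᶜˢ) ≤ 4 ⟹ 0 ≤ threeSetN 𝒜 ℬ 𝒞` for all up-sets `ℬ, 𝒞` (families of `Fin n`; primed
version for any finite cube).  With `W = ℬ ∩ 𝒞`, `F = 𝒜 ∩ 𝒜ᶜˢ`, `threeSetN = twoPartN 𝒜 W + #(Fℬ𝒞) − #(Fℬ𝒞ᶜˢ)`, and `x ∈ F` DISAGREEING if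
`x ∈ ℬ ∖ 𝒞`, `xᶜ ∈ 𝒞 ∖ ℬ`: no disagreeing element ⟹ `#(Fℬ𝒞ᶜˢ) ≤ #(Fℬ𝒞)`; exactly one, `x₁` ⟹ `≤ #(Fℬ𝒞) + 1` and one of `x₁, x₁ᶜ` is minimal
in `𝒜` (`minimal_or_minimal_compl`), invisible to `W`, so the hole lemma gives `twoPartN 𝒜 W ≥ 1`; two, `p, r` with `p ⊄ r` ⟹ `#(Fℬ𝒞ᶜˢ) ≤ 2` and
`two_le_twoPartN_of_two_disagree`: split at `i ∈ p ∖ r`; layer 0 has the invisible minimal hole `r` (slack ≥ 1); layer 1 has the hole `p` unless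
`pᶜ ∪ {i} ∈ ℬ`, in which case the rung at `p ∖ i` is `1` (`p ∖ i ∉ 𝒜`: it could only be `r`, whose complement `pᶜ ∪ {i}` is not in `ℬ`).
SCOPE: 195 more of the 562 pinched up-sets of `2^[5]` (peeling with the `|F| ≤ 4` leaf covers 7 404 / 7 581, evidence `code-g30/peelclass3.py`);
sub-claims checked numerically first (`code-g30/twopair2.py`).  HONEST LABEL: one more face; `ThreeSetAntipodal` (hence `SQKD`) stays OPEN. [this work]
-/

namespace Summit.CriticalPhenomena.PercolationContinuityZ3.Theorems.TwoPartition

open Finset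
open scoped FinsetFamily

section Aux

variable {α : Type*} [DecidableEq α] [Fintype α]

omit [Fintype α] in
/-- Inserting a fresh element preserves strict inclusion. [folklore] -/
theorem insert_ssubset_insert_of_notMem {s t : Finset α} {i : α} (h : s ⊂ t) (hit : i ∉ t) : insert i s ⊂ insert i t := by
  refine lt_of_le_of_ne (insert_subset_insert i h.subset) fun heq => h.ne ?_
  have his : i ∉ s := fun hi => hit (h.subset hi)
  rw [← erase_insert his, heq, erase_insert hit]

/-- A nonempty complement is never a strict subset of the set. [folklore] -/
theorem compl_not_ssubset_self {x : Finset α} (hne : xᶜ ≠ ∅) : ¬ xᶜ ⊂ x := by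
  intro h
  apply hne
  refine eq_empty_of_forall_notMem fun a ha => ?_
  have := h.subset ha
  rw [mem_compl] at ha
  exact ha this

/-- Members of `𝒜` strictly below a complementary-pair element are themselves in a complementary pair. [this work] -/
theorem mem_inter_compls_of_ssubset {𝒜 : Finset (Finset α)} (h𝒜 : IsUpperSet (𝒜 : Set (Finset α))) {S x : Finset α} (hS : S ∈ 𝒜)
    (hx : x ∈ 𝒜 ∩ 𝒜ᶜˢ) (hSx : S ⊂ x) : S ∈ 𝒜 ∩ 𝒜ᶜˢ := by
  rw [mem_inter, mem_compls] at hx ⊢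
  exact ⟨hS, h𝒜 (compl_subset_compl.2 hSx.subset) hx.2⟩

/-- If there is no "disagreeing" element (`w ∈ ℬ ∖ 𝒞`, `wᶜ ∈ 𝒞 ∖ ℬ`) in `F = 𝒜 ∩ 𝒜ᶜˢ` outside `D`, then
`#(F ∩ ℬ ∩ 𝒞ᶜˢ ∖ D) ≤ #(F ∩ ℬ ∩ 𝒞)` via `w ↦ w` (if `w ∈ 𝒞`) or `wᶜ`. [this work] -/
theorem card_sdiff_le_of_no_disagree {𝒜 ℬ 𝒞 : Finset (Finset α)} (D : Finset (Finset α))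
    (hnd : ∀ w ∈ 𝒜 ∩ 𝒜ᶜˢ, w ∉ D → w ∈ ℬ → w ∉ 𝒞 → wᶜ ∈ 𝒞 → wᶜ ∈ ℬ) :
    #((𝒜 ∩ 𝒜ᶜˢ ∩ ℬ ∩ 𝒞ᶜˢ) \ D) ≤ #(𝒜 ∩ 𝒜ᶜˢ ∩ ℬ ∩ 𝒞) := by
  refine card_le_card_of_injOn (fun w => if w ∈ 𝒞 then w else wᶜ) (fun w hw => ?_) ?_
  · rw [mem_coe, mem_sdiff, mem_inter, mem_inter, mem_compls] at hw
    obtain ⟨⟨⟨hwF, hwB⟩, hwcC⟩, hwD⟩ := hw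
    dsimp only
    by_cases hwC : w ∈ 𝒞
    · rw [if_pos hwC, mem_coe, mem_inter, mem_inter]; exact ⟨⟨hwF, hwB⟩, hwC⟩
    · have hwcB : wᶜ ∈ ℬ := hnd w hwF hwD hwB hwC hwcC
      rw [if_neg hwC, mem_coe, mem_inter, mem_inter]
      refine ⟨⟨?_, hwcB⟩, hwcC⟩
      rw [mem_inter, mem_compls] at hwF ⊢
      rw [compl_compl]; exact ⟨hwF.2, hwF.1⟩
  · intro w hw w' hw' hww'
    rw [mem_coe, mem_sdiff, mem_inter, mem_inter, mem_compls] at hw hw'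
    dsimp only at hww'
    by_cases hwC : w ∈ 𝒞 <;> by_cases hw'C : w' ∈ 𝒞
    · rwa [if_pos hwC, if_pos hw'C] at hww'
    · rw [if_pos hwC, if_neg hw'C] at hww'
      exfalso; apply hw'C; rw [← compl_compl w', ← hww']; exact hw.1.2
    · rw [if_neg hwC, if_pos hw'C] at hww'
      exfalso; apply hwC; rw [← compl_compl w, hww']; exact hw'.1.2
    · rw [if_neg hwC, if_neg hw'C] at hww'
      exact compl_injective hww'

end Aux


section TwoPairs

variable {α : Type*} [DecidableEq α] [Fintype α]

/-- With `F = {v, vᶜ, w, wᶜ}` and `∅ ∉ 𝒜`: one of `v, vᶜ` is minimal in `𝒜`. [this work] -/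
theorem minimal_or_minimal_compl {𝒜 : Finset (Finset α)} (h𝒜 : IsUpperSet (𝒜 : Set (Finset α))) (h0 : ∅ ∉ 𝒜) {v w : Finset α}
    (hF : 𝒜 ∩ 𝒜ᶜˢ = {v, vᶜ, w, wᶜ}) :
    (∀ S ∈ 𝒜, ¬ S ⊂ v) ∨ (∀ S ∈ 𝒜, ¬ S ⊂ vᶜ) := by
  have hvF : v ∈ 𝒜 ∩ 𝒜ᶜˢ := by rw [hF]; simp
  have hvcF : vᶜ ∈ 𝒜 ∩ 𝒜ᶜˢ := by rw [hF]; simp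
  have hvA : v ∈ 𝒜 := (mem_inter.1 hvF).1; have hvcA : vᶜ ∈ 𝒜 := (mem_inter.1 hvcF).1
  have ne1 : vᶜ ≠ ∅ := fun h => h0 (h ▸ hvcA)
  have below_v : ∀ S ∈ 𝒜, S ⊂ v → S = w ∨ S = wᶜ := by
    intro S hS hSv
    have hSF := mem_inter_compls_of_ssubset h𝒜 hS hvF hSv
    rw [hF] at hSF
    simp only [mem_insert, mem_singleton] at hSF
    rcases hSF with h | h | h | h
    · exact absurd (h ▸ hSv) (lt_irrefl _)
    · rw [h] at hSv; exact absurd hSv (compl_not_ssubset_self ne1)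
    · exact Or.inl h
    · exact Or.inr h
  have below_vc : ∀ S ∈ 𝒜, S ⊂ vᶜ → S = w ∨ S = wᶜ := by
    intro S hS hSv
    have hSF := mem_inter_compls_of_ssubset h𝒜 hS hvcF hSv
    rw [hF] at hSF
    simp only [mem_insert, mem_singleton] at hSF
    rcases hSF with h | h | h | h
    · rw [h] at hSv
      have ne2 : vᶜᶜ ≠ ∅ := by rw [compl_compl]; exact fun h' => h0 (h' ▸ hvA)
      have := compl_not_ssubset_self ne2
      rw [compl_compl] at this
      exact absurd hSv this
    · exact absurd (h ▸ hSv) (lt_irrefl _)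
    · exact Or.inl h
    · exact Or.inr h
  have key : ∀ y : Finset α, y ⊂ v → ¬ yᶜ ⊂ vᶜ := fun y h h' => (compl_ssubset_compl.1 h').asymm h
  have key' : ∀ y : Finset α, y ∈ 𝒜 → y ⊂ v → ¬ y ⊂ vᶜ := by
    intro y hy h h'
    have : y = ∅ := by
      rw [← subset_empty]; intro a ha
      have h1 := h.subset ha; have h2 := h'.subset ha
      rw [mem_compl] at h2; exact absurd h1 h2
    exact h0 (this ▸ hy)
  by_contra hcon
  rw [not_or] at hcon
  obtain ⟨h1, h2⟩ := hcon
  simp only [not_forall, not_not] at h1 h2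
  obtain ⟨S, hS, hSv⟩ := h1
  obtain ⟨S', hS', hS'v⟩ := h2
  rcases below_v S hS hSv with h | h <;> rcases below_vc S' hS' hS'v with h' | h'
  · -- S = w, S' = w
    rw [h] at hSv hS; rw [h'] at hS'v; exact key' w hS hSv hS'v
  · -- S = w, S' = wᶜ
    rw [h] at hSv; rw [h'] at hS'v; exact key w hSv hS'v
  · -- S = wᶜ, S' = w
    rw [h] at hSv; rw [h'] at hS'v
    exact key wᶜ hSv (by rw [compl_compl]; exact hS'v)
  · -- S = wᶜ, S' = wᶜ
    rw [h] at hSv hS; rw [h'] at hS'v; exact key' wᶜ hS hSv hS'v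

/-- From `2 < #F ≤ 4` (`F = 𝒜 ∩ 𝒜ᶜˢ`, `∅ ∉ 𝒜`) and `v ∈ F`: `F = {v, vᶜ, w, wᶜ}` for some `w`. [this work] -/
theorem exists_eq_four {𝒜 : Finset (Finset α)} (h0 : ∅ ∉ 𝒜) (h2 : ¬ #(𝒜 ∩ 𝒜ᶜˢ) ≤ 2) (h4 : #(𝒜 ∩ 𝒜ᶜˢ) ≤ 4)
    {v : Finset α} (hv : v ∈ 𝒜 ∩ 𝒜ᶜˢ) : ∃ w, 𝒜 ∩ 𝒜ᶜˢ = {v, vᶜ, w, wᶜ} := by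
  have hcl : ∀ x ∈ 𝒜 ∩ 𝒜ᶜˢ, xᶜ ∈ 𝒜 ∩ 𝒜ᶜˢ := fun x hx => by
    rw [mem_inter, mem_compls] at hx ⊢; rw [compl_compl]; exact ⟨hx.2, hx.1⟩
  have hne : ∀ x ∈ 𝒜 ∩ 𝒜ᶜˢ, x ≠ xᶜ := fun x hx h => by
    have : x = ∅ := by
      rw [← subset_empty]; intro a ha
      have ha' : a ∈ xᶜ := h ▸ ha
      rw [mem_compl] at ha'; exact absurd ha ha'
    exact h0 (this ▸ (mem_inter.1 hx).1)
  have hvc := hcl v hv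
  have h3 : 0 < #(((𝒜 ∩ 𝒜ᶜˢ).erase v).erase vᶜ) := by
    rw [card_erase_of_mem (mem_erase.2 ⟨(hne v hv).symm, hvc⟩), card_erase_of_mem hv]; omega
  obtain ⟨w, hw⟩ := card_pos.1 h3
  rw [mem_erase, mem_erase] at hw
  obtain ⟨hwvc, hwv, hwF⟩ := hw
  have hwc := hcl w hwF
  have hwcv : wᶜ ≠ v := fun h => hwvc (by rw [← h, compl_compl])
  have hwcvc : wᶜ ≠ vᶜ := fun h => hwv (compl_injective h)
  have hwwc : w ≠ wᶜ := hne w hwF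
  refine ⟨w, (eq_of_subset_of_card_le (fun x hx => ?_) ?_).symm⟩
  · simp only [mem_insert, mem_singleton] at hx
    rcases hx with rfl | rfl | rfl | rfl <;> assumption
  · have : #({v, vᶜ, w, wᶜ} : Finset (Finset α)) = 4 := by
      have n1 : v ∉ ({vᶜ, w, wᶜ} : Finset (Finset α)) := by
        simp only [mem_insert, mem_singleton, not_or]; exact ⟨hne v hv, fun h => hwv h.symm, fun h => hwcv h.symm⟩
      have n2 : vᶜ ∉ ({w, wᶜ} : Finset (Finset α)) := by
        simp only [mem_insert, mem_singleton, not_or]; exact ⟨fun h => hwvc h.symm, fun h => hwcvc h.symm⟩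
      rw [card_insert_of_notMem n1, card_insert_of_notMem n2, card_pair hwwc]
    omega

end TwoPairs


section Slack

variable {m : ℕ}

/-- **Slack two** (this work): if `𝒜 ∩ 𝒜ᶜˢ = {p, pᶜ, r, rᶜ}` with `∅ ∉ 𝒜`, both pairs disagree (`p, r ∈ ℬ ∖ 𝒞`, `pᶜ, rᶜ ∈ 𝒞 ∖ ℬ`) and `p ⊄ r`,
then `2 ≤ twoPartN 𝒜 (ℬ ∩ 𝒞)`.  Split at `i ∈ p ∖ r`: hole at `r` in layer 0; hole at `p` in layer 1 or the rung at `p ∖ i`. [this work] -/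
theorem two_le_twoPartN_of_two_disagree {𝒜 ℬ 𝒞 : Finset (Finset (Fin (m + 1)))} (h𝒜 : IsUpperSet (𝒜 : Set (Finset (Fin (m + 1)))))
    (hℬ : IsUpperSet (ℬ : Set (Finset (Fin (m + 1))))) (h𝒞 : IsUpperSet (𝒞 : Set (Finset (Fin (m + 1))))) (h0 : ∅ ∉ 𝒜)
    {p r : Finset (Fin (m + 1))} (hF : 𝒜 ∩ 𝒜ᶜˢ = {p, pᶜ, r, rᶜ})
    (hpB : p ∈ ℬ) (hpC : p ∉ 𝒞) (hpcC : pᶜ ∈ 𝒞) (hpcB : pᶜ ∉ ℬ)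
    (hrB : r ∈ ℬ) (hrC : r ∉ 𝒞) (hrcC : rᶜ ∈ 𝒞) (hrcB : rᶜ ∉ ℬ) (hpr : ¬ p ⊆ r) :
    2 ≤ twoPartN 𝒜 (ℬ ∩ 𝒞) := by
  have hW : IsUpperSet ((ℬ ∩ 𝒞 : Finset (Finset (Fin (m + 1)))) : Set (Finset (Fin (m + 1)))) := by
    rw [coe_inter]; exact hℬ.inter h𝒞
  have hpF : p ∈ 𝒜 ∩ 𝒜ᶜˢ := by rw [hF]; simp
  have hrF : r ∈ 𝒜 ∩ 𝒜ᶜˢ := by rw [hF]; simp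
  have hpA : p ∈ 𝒜 := (mem_inter.1 hpF).1; have hrA : r ∈ 𝒜 := (mem_inter.1 hrF).1
  have hrcA : rᶜ ∈ 𝒜 := mem_compls.1 (mem_inter.1 hrF).2
  have hpcA : pᶜ ∈ 𝒜 := mem_compls.1 (mem_inter.1 hpF).2
  have hpcr : ¬ pᶜ ⊆ r := fun h => hrC (h𝒞 h hpcC)
  have hrcp : ¬ rᶜ ⊆ p := fun h => hpC (h𝒞 h hrcC)
  have hrcne : rᶜ ≠ ∅ := fun h => h0 (h ▸ hrcA)
  have hpcne : pᶜ ≠ ∅ := fun h => h0 (h ▸ hpcA)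
  obtain ⟨i, hip, hir⟩ := not_subset.1 hpr
  have hipc : i ∉ pᶜ := fun h => (mem_compl.1 h) hip
  have hirc : i ∈ rᶜ := mem_compl.2 hir
  have memF : ∀ S, S ∈ 𝒜 ∩ 𝒜ᶜˢ → S = p ∨ S = pᶜ ∨ S = r ∨ S = rᶜ := by
    intro S hS; rw [hF] at hS; simpa only [mem_insert, mem_singleton] using hS
  have hX : IsUpperSet ((famMap ((finSuccEquiv' i).trans (Equiv.optionEquivSumPUnit.{0, 0} (Fin m))) 𝒜 : Finset (Finset (Fin m ⊕ Unit))) : Set (Finset (Fin m ⊕ Unit))) := isUpperSet_famMap _ h𝒜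
  have hY : IsUpperSet ((famMap ((finSuccEquiv' i).trans (Equiv.optionEquivSumPUnit.{0, 0} (Fin m))) (ℬ ∩ 𝒞) : Finset (Finset (Fin m ⊕ Unit))) : Set (Finset (Fin m ⊕ Unit))) :=
    isUpperSet_famMap _ hW
  have hX0 := isUpperSet_fib hX (∅ : Finset Unit); have hX1 := isUpperSet_fib hX (univ : Finset Unit)
  have hY0 := isUpperSet_fib hY (∅ : Finset Unit); have hY1 := isUpperSet_fib hY (univ : Finset Unit)
  rw [← twoPartN_famMap ((finSuccEquiv' i).trans (Equiv.optionEquivSumPUnit.{0, 0} (Fin m)))]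
  have hsplit := twoPartN_fib_add_fib_add_rung_le hX hY (univ.filter fun j => i.succAbove j ∈ p)
  have pull_univ : (univ.filter fun j : Fin m => i.succAbove j ∈ (univ : Finset (Fin (m + 1)))) = univ :=
    filter_true_of_mem fun j _ => mem_univ _
  have map_univ : (univ : Finset (Fin m)).map (Fin.succAboveEmb i) = univ.erase i := by
    rw [← pull_univ, map_pull_succAbove]
  have huniv_erase_W : (univ : Finset (Fin (m + 1))).erase i ∈ ℬ ∩ 𝒞 :=
    mem_inter.2 ⟨hℬ (fun x hx => mem_erase.2 ⟨fun h => hir (h ▸ hx), mem_univ _⟩) hrB,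
      h𝒞 (fun x hx => mem_erase.2 ⟨fun h => hipc (h ▸ hx), mem_univ _⟩) hpcC⟩
  have t0 : 1 ≤ twoPartN (fib (famMap ((finSuccEquiv' i).trans (Equiv.optionEquivSumPUnit.{0, 0} (Fin m))) 𝒜) ∅) (fib (famMap ((finSuccEquiv' i).trans (Equiv.optionEquivSumPUnit.{0, 0} (Fin m))) (ℬ ∩ 𝒞)) ∅) := by
    refine one_le_twoPartN_of_minimal hX0 hY0 (m := univ.filter fun j => i.succAbove j ∈ r)
      ((pull_mem_fib_empty_iff i 𝒜 hir).2 hrA) (fun S hS hlt => ?_) ?_ ?_ ?_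
    · have hS' : S.map (Fin.succAboveEmb i) ∈ 𝒜 := (mem_fib_splitAt_empty i 𝒜 S).1 hS
      have hlt' : S.map (Fin.succAboveEmb i) ⊂ r := by
        have := (Finset.map_ssubset_map (f := Fin.succAboveEmb i)).2 hlt
        rwa [map_pull_succAbove, erase_eq_of_notMem hir] at this
      rcases memF _ (mem_inter_compls_of_ssubset h𝒜 hS' hrF hlt') with h | h | h | h
      · exact hpr (h ▸ hlt'.subset)
      · exact hpcr (h ▸ hlt'.subset)
      · exact hlt'.ne h
      · rw [h] at hlt'; exact compl_not_ssubset_self hrcne hlt'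
    · rw [pull_mem_fib_empty_iff i (ℬ ∩ 𝒞) hir]; exact fun h => hrC (mem_inter.1 h).2
    · rw [pull_compl, mem_fib_splitAt_empty, map_pull_succAbove]
      exact fun h => hrcB (hℬ (erase_subset i rᶜ) (mem_inter.1 h).1)
    · rw [mem_fib_splitAt_empty, map_univ]; exact huniv_erase_W
  have t1nn : 0 ≤ twoPartN (fib (famMap ((finSuccEquiv' i).trans (Equiv.optionEquivSumPUnit.{0, 0} (Fin m))) 𝒜) univ) (fib (famMap ((finSuccEquiv' i).trans (Equiv.optionEquivSumPUnit.{0, 0} (Fin m))) (ℬ ∩ 𝒞)) univ) := twoPartN_nonneg hX1 hY1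
  have hrung : 0 ≤ (chi (famMap ((finSuccEquiv' i).trans (Equiv.optionEquivSumPUnit.{0, 0} (Fin m))) 𝒜) ((univ.filter fun j => i.succAbove j ∈ p).disjSum (univ : Finset Unit))
        - chi (famMap ((finSuccEquiv' i).trans (Equiv.optionEquivSumPUnit.{0, 0} (Fin m))) 𝒜) ((univ.filter fun j => i.succAbove j ∈ p).disjSum (∅ : Finset Unit)))
      * (chi (famMap ((finSuccEquiv' i).trans (Equiv.optionEquivSumPUnit.{0, 0} (Fin m))) (ℬ ∩ 𝒞)) ((univ.filter fun j => i.succAbove j ∈ p)ᶜ.disjSum (univ : Finset Unit))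
        - chi (famMap ((finSuccEquiv' i).trans (Equiv.optionEquivSumPUnit.{0, 0} (Fin m))) (ℬ ∩ 𝒞)) ((univ.filter fun j => i.succAbove j ∈ p)ᶜ.disjSum (∅ : Finset Unit))) :=
    mul_nonneg (sub_nonneg.2 (chi_fib_empty_le hX _)) (sub_nonneg.2 (chi_fib_empty_le hY _))
  have hm1 : (univ.filter fun j => i.succAbove j ∈ p) ∈ fib (famMap ((finSuccEquiv' i).trans (Equiv.optionEquivSumPUnit.{0, 0} (Fin m))) 𝒜) (univ : Finset Unit) := by
    rw [pull_mem_fib_univ_iff, insert_eq_of_mem hip]; exact hpA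
  by_cases hb : insert i pᶜ ∈ ℬ
  · -- (2a) the rung at `p ∖ i` equals `1`
    have hbW : insert i pᶜ ∈ ℬ ∩ 𝒞 := mem_inter.2 ⟨hb, h𝒞 (subset_insert i pᶜ) hpcC⟩
    have hperase : p.erase i ∉ 𝒜 := by
      intro h
      have hlt : p.erase i ⊂ p := erase_ssubset hip
      rcases memF _ (mem_inter_compls_of_ssubset h𝒜 h hpF hlt) with h' | h' | h' | h'
      · exact hlt.ne h'
      · rw [h'] at hlt; exact compl_not_ssubset_self hpcne hlt
      · apply hrcB; rw [← h', compl_erase]; exact hb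
      · have : i ∈ p.erase i := by rw [h']; exact hirc
        exact (mem_erase.1 this).1 rfl
    have h2' : (univ.filter fun j => i.succAbove j ∈ p) ∉ fib (famMap ((finSuccEquiv' i).trans (Equiv.optionEquivSumPUnit.{0, 0} (Fin m))) 𝒜) (∅ : Finset Unit) := by
      rw [mem_fib_splitAt_empty, map_pull_succAbove]; exact hperase
    have h3' : (univ.filter fun j => i.succAbove j ∈ p)ᶜ ∈ fib (famMap ((finSuccEquiv' i).trans (Equiv.optionEquivSumPUnit.{0, 0} (Fin m))) (ℬ ∩ 𝒞)) (univ : Finset Unit) := by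
      rw [pull_compl, pull_mem_fib_univ_iff]; exact hbW
    have h4' : (univ.filter fun j => i.succAbove j ∈ p)ᶜ ∉ fib (famMap ((finSuccEquiv' i).trans (Equiv.optionEquivSumPUnit.{0, 0} (Fin m))) (ℬ ∩ 𝒞)) (∅ : Finset Unit) := by
      rw [pull_compl, pull_mem_fib_empty_iff i (ℬ ∩ 𝒞) hipc]; exact fun h => hpcB (mem_inter.1 h).1
    have c1 : chi (famMap ((finSuccEquiv' i).trans (Equiv.optionEquivSumPUnit.{0, 0} (Fin m))) 𝒜) ((univ.filter fun j => i.succAbove j ∈ p).disjSum (univ : Finset Unit)) = 1 := by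
      unfold chi; rw [if_pos (mem_fib.1 hm1)]
    have c2 : chi (famMap ((finSuccEquiv' i).trans (Equiv.optionEquivSumPUnit.{0, 0} (Fin m))) 𝒜) ((univ.filter fun j => i.succAbove j ∈ p).disjSum (∅ : Finset Unit)) = 0 := by
      unfold chi; rw [if_neg (fun h => h2' (mem_fib.2 h))]
    have c3 : chi (famMap ((finSuccEquiv' i).trans (Equiv.optionEquivSumPUnit.{0, 0} (Fin m))) (ℬ ∩ 𝒞)) ((univ.filter fun j => i.succAbove j ∈ p)ᶜ.disjSum (univ : Finset Unit)) = 1 := by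
      unfold chi; rw [if_pos (mem_fib.1 h3')]
    have c4 : chi (famMap ((finSuccEquiv' i).trans (Equiv.optionEquivSumPUnit.{0, 0} (Fin m))) (ℬ ∩ 𝒞)) ((univ.filter fun j => i.succAbove j ∈ p)ᶜ.disjSum (∅ : Finset Unit)) = 0 := by
      unfold chi; rw [if_neg (fun h => h4' (mem_fib.2 h))]
    rw [c1, c2, c3, c4] at hsplit
    linarith
  · -- (2b) the hole at `p` in layer 1
    have t1 : 1 ≤ twoPartN (fib (famMap ((finSuccEquiv' i).trans (Equiv.optionEquivSumPUnit.{0, 0} (Fin m))) 𝒜) univ) (fib (famMap ((finSuccEquiv' i).trans (Equiv.optionEquivSumPUnit.{0, 0} (Fin m))) (ℬ ∩ 𝒞)) univ) := by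
      refine one_le_twoPartN_of_minimal hX1 hY1 hm1 (fun S hS hlt => ?_) ?_ ?_ ?_
      · have hS' : insert i (S.map (Fin.succAboveEmb i)) ∈ 𝒜 := (mem_fib_splitAt_univ i 𝒜 S).1 hS
        have hlt' : S.map (Fin.succAboveEmb i) ⊂ p.erase i := by
          have := (Finset.map_ssubset_map (f := Fin.succAboveEmb i)).2 hlt
          rwa [map_pull_succAbove] at this
        have hlt'' : insert i (S.map (Fin.succAboveEmb i)) ⊂ p := by
          have := insert_ssubset_insert_of_notMem hlt' (fun h => (mem_erase.1 h).1 rfl)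
          rwa [insert_erase hip] at this
        have hi_mem : i ∈ insert i (S.map (Fin.succAboveEmb i)) := mem_insert_self _ _
        rcases memF _ (mem_inter_compls_of_ssubset h𝒜 hS' hpF hlt'') with h | h | h | h
        · exact hlt''.ne h
        · rw [h] at hi_mem; exact hipc hi_mem
        · rw [h] at hi_mem; exact hir hi_mem
        · rw [h] at hlt''; exact hrcp hlt''.subset
      · rw [pull_mem_fib_univ_iff, insert_eq_of_mem hip]; exact fun h => hpC (mem_inter.1 h).2
      · rw [pull_compl, pull_mem_fib_univ_iff]; exact fun h => hb (mem_inter.1 h).1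
      · rw [← pull_univ, pull_mem_fib_univ_iff, insert_eq_of_mem (mem_univ i)]
        exact mem_inter.2 ⟨hℬ (subset_univ p) hpB, h𝒞 (subset_univ pᶜ) hpcC⟩
    linarith

end Slack


section Face

/-- **`ThreeSetAntipodal` for up-sets with at most two complementary pairs** (this work, unconditional): if `#(𝒜 ∩ 𝒜ᶜˢ) ≤ 4` then
`0 ≤ threeSetN 𝒜 ℬ 𝒞` for all up-sets `ℬ, 𝒞` of `2^[n]`. [this work] -/
theorem threeSetN_nonneg_of_card_inter_compls_le_four : ∀ {n : ℕ} {𝒜 ℬ 𝒞 : Finset (Finset (Fin n))},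
    IsUpperSet (𝒜 : Set (Finset (Fin n))) → IsUpperSet (ℬ : Set (Finset (Fin n))) → IsUpperSet (𝒞 : Set (Finset (Fin n))) →
    #(𝒜 ∩ 𝒜ᶜˢ) ≤ 4 → 0 ≤ threeSetN 𝒜 ℬ 𝒞 := by
  intro n
  cases n with
  | zero =>
    intro 𝒜 ℬ 𝒞 h𝒜 hℬ h𝒞 _
    rcases eq_empty_or_eq_univ_fin_zero 𝒜 with h | h
    · rw [h] at h𝒜 ⊢; exact threeSetN_nonneg_of_inter_compls_eq_empty h𝒜 hℬ h𝒞 (empty_inter _)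
    · rw [h]; exact threeSetN_nonneg_univ_left hℬ h𝒞
  | succ m =>
    intro 𝒜 ℬ 𝒞 h𝒜 hℬ h𝒞 h4
    by_cases h0 : ∅ ∈ 𝒜
    · have : 𝒜 = univ := eq_univ_of_forall fun S => h𝒜 (empty_subset S) h0
      rw [this]; exact threeSetN_nonneg_univ_left hℬ h𝒞
    by_cases h2 : #(𝒜 ∩ 𝒜ᶜˢ) ≤ 2
    · exact threeSetN_nonneg_of_card_inter_compls_le_two h𝒜 hℬ h𝒞 h2
    have hW : IsUpperSet ((ℬ ∩ 𝒞 : Finset (Finset (Fin (m + 1)))) : Set (Finset (Fin (m + 1)))) := by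
      rw [coe_inter]; exact hℬ.inter h𝒞
    have hT : 0 ≤ twoPartN 𝒜 (ℬ ∩ 𝒞) := twoPartN_nonneg h𝒜 hW
    have hcl : ∀ x ∈ 𝒜 ∩ 𝒜ᶜˢ, xᶜ ∈ 𝒜 ∩ 𝒜ᶜˢ := fun x hx => by
      rw [mem_inter, mem_compls] at hx ⊢; rw [compl_compl]; exact ⟨hx.2, hx.1⟩
    rw [threeSetN_eq_twoPartN_self_add]
    by_cases hex : ∃ x ∈ 𝒜 ∩ 𝒜ᶜˢ, x ∈ ℬ ∧ x ∉ 𝒞 ∧ xᶜ ∈ 𝒞 ∧ xᶜ ∉ ℬ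
    swap
    · -- no disagreeing pair
      have hle := card_sdiff_le_of_no_disagree (𝒜 := 𝒜) (ℬ := ℬ) (𝒞 := 𝒞) ∅ (fun w hwF _ hwB hwC hwcC => by
        by_contra h; exact hex ⟨w, hwF, hwB, hwC, hwcC, h⟩)
      rw [sdiff_empty] at hle
      have : (#(𝒜 ∩ 𝒜ᶜˢ ∩ ℬ ∩ 𝒞ᶜˢ) : ℤ) ≤ #(𝒜 ∩ 𝒜ᶜˢ ∩ ℬ ∩ 𝒞) := by exact_mod_cast hle
      linarith
    obtain ⟨x₁, hx₁F, hx₁B, hx₁C, hx₁cC, hx₁cB⟩ := hex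
    have huniv : (univ : Finset (Fin (m + 1))) ∈ ℬ ∩ 𝒞 :=
      mem_inter.2 ⟨hℬ (subset_univ x₁) hx₁B, h𝒞 (subset_univ x₁ᶜ) hx₁cC⟩
    obtain ⟨w, hFw⟩ := exists_eq_four h0 h2 h4 hx₁F
    by_cases hex2 : ∃ x ∈ 𝒜 ∩ 𝒜ᶜˢ, (x ∈ ℬ ∧ x ∉ 𝒞 ∧ xᶜ ∈ 𝒞 ∧ xᶜ ∉ ℬ) ∧ x ≠ x₁
    · -- two disagreeing pairs: `F = {x₁, x₁ᶜ, x₂, x₂ᶜ}` and the Kleitman term is `≥ 2`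
      obtain ⟨x₂, hx₂F, ⟨hx₂B, hx₂C, hx₂cC, hx₂cB⟩, hne⟩ := hex2
      have hne' : x₂ ≠ x₁ᶜ := fun h => hx₁cB (h ▸ hx₂B)
      have hx₂w : x₂ = w ∨ x₂ = wᶜ := by
        have := hx₂F; rw [hFw] at this
        simp only [mem_insert, mem_singleton] at this
        rcases this with h | h | h | h
        · exact absurd h hne
        · exact absurd h hne'
        · exact Or.inl h
        · exact Or.inr h
      have hF2 : 𝒜 ∩ 𝒜ᶜˢ = {x₁, x₁ᶜ, x₂, x₂ᶜ} := by
        rw [hFw]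
        rcases hx₂w with rfl | rfl
        · rfl
        · rw [compl_compl]; ext S; simp only [mem_insert, mem_singleton]; tauto
      have hneg : #(𝒜 ∩ 𝒜ᶜˢ ∩ ℬ ∩ 𝒞ᶜˢ) ≤ 2 := by
        calc #(𝒜 ∩ 𝒜ᶜˢ ∩ ℬ ∩ 𝒞ᶜˢ) ≤ #({x₁, x₂} : Finset (Finset (Fin (m + 1)))) := card_le_card (fun S hS => by
                rw [mem_inter, mem_inter, hF2] at hS
                simp only [mem_insert, mem_singleton] at hS ⊢
                rcases hS with ⟨⟨h | h | h | h, hB⟩, _⟩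
                · exact Or.inl h
                · exact absurd hB (h ▸ hx₁cB)
                · exact Or.inr h
                · exact absurd hB (h ▸ hx₂cB))
          _ ≤ 2 := card_insert_le _ _ |>.trans (by rw [card_singleton])
      have hslack : 2 ≤ twoPartN 𝒜 (ℬ ∩ 𝒞) := by
        by_cases hsub : x₁ ⊆ x₂
        · have hns : ¬ x₂ ⊆ x₁ := fun h => hne (subset_antisymm h hsub)
          have hF3 : 𝒜 ∩ 𝒜ᶜˢ = {x₂, x₂ᶜ, x₁, x₁ᶜ} := by
            rw [hF2]; ext S; simp only [mem_insert, mem_singleton]; tauto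
          exact two_le_twoPartN_of_two_disagree h𝒜 hℬ h𝒞 h0 hF3 hx₂B hx₂C hx₂cC hx₂cB hx₁B hx₁C hx₁cC hx₁cB hns
        · exact two_le_twoPartN_of_two_disagree h𝒜 hℬ h𝒞 h0 hF2 hx₁B hx₁C hx₁cC hx₁cB hx₂B hx₂C hx₂cC hx₂cB hsub
      have : (#(𝒜 ∩ 𝒜ᶜˢ ∩ ℬ ∩ 𝒞ᶜˢ) : ℤ) ≤ 2 := by exact_mod_cast hneg
      have : (0 : ℤ) ≤ #(𝒜 ∩ 𝒜ᶜˢ ∩ ℬ ∩ 𝒞) := by exact_mod_cast Nat.zero_le _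
      linarith
    · -- exactly one disagreeing element `x₁`: the others inject, and the hole at the minimal member of `{x₁, x₁ᶜ}` pays for it
      have hle := card_sdiff_le_of_no_disagree (𝒜 := 𝒜) (ℬ := ℬ) (𝒞 := 𝒞) {x₁} (fun w hwF hwD hwB hwC hwcC => by
        by_contra h
        exact hex2 ⟨w, hwF, ⟨hwB, hwC, hwcC, h⟩, fun heq => hwD (mem_singleton.2 heq)⟩)
      have hle2 : #(𝒜 ∩ 𝒜ᶜˢ ∩ ℬ ∩ 𝒞ᶜˢ) ≤ #(𝒜 ∩ 𝒜ᶜˢ ∩ ℬ ∩ 𝒞) + 1 :=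
        (card_le_card_sdiff_add_card (s := 𝒜 ∩ 𝒜ᶜˢ ∩ ℬ ∩ 𝒞ᶜˢ) (t := {x₁})).trans (by rw [card_singleton]; omega)
      have hslack : 1 ≤ twoPartN 𝒜 (ℬ ∩ 𝒞) := by
        rcases minimal_or_minimal_compl h𝒜 h0 hFw with hmin | hmin
        · exact one_le_twoPartN_of_minimal h𝒜 hW (mem_inter.1 hx₁F).1 hmin (fun h => hx₁C (mem_inter.1 h).2)
            (fun h => hx₁cB (mem_inter.1 h).1) huniv
        · exact one_le_twoPartN_of_minimal h𝒜 hW (mem_inter.1 (hcl x₁ hx₁F)).1 hmin (fun h => hx₁cB (mem_inter.1 h).1)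
            (fun h => hx₁C (by rw [compl_compl] at h; exact (mem_inter.1 h).2)) huniv
      have : (#(𝒜 ∩ 𝒜ᶜˢ ∩ ℬ ∩ 𝒞ᶜˢ) : ℤ) ≤ #(𝒜 ∩ 𝒜ᶜˢ ∩ ℬ ∩ 𝒞) + 1 := by exact_mod_cast hle2
      linarith

/-- The same on an arbitrary finite cube `2^α`. [this work] -/
theorem threeSetN_nonneg_of_card_inter_compls_le_four' {α : Type*} [DecidableEq α] [Fintype α] {𝒜 ℬ 𝒞 : Finset (Finset α)}
    (h𝒜 : IsUpperSet (𝒜 : Set (Finset α))) (hℬ : IsUpperSet (ℬ : Set (Finset α))) (h𝒞 : IsUpperSet (𝒞 : Set (Finset α)))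
    (h4 : #(𝒜 ∩ 𝒜ᶜˢ) ≤ 4) : 0 ≤ threeSetN 𝒜 ℬ 𝒞 := by
  let e := Fintype.equivFin α
  rw [← threeSetN_famMap e]
  refine threeSetN_nonneg_of_card_inter_compls_le_four (isUpperSet_famMap e h𝒜) (isUpperSet_famMap e hℬ) (isUpperSet_famMap e h𝒞) ?_
  rw [← famMap_compls, ← famMap_inter, card_famMap]; exact h4

end Face

end Summit.CriticalPhenomena.PercolationContinuityZ3.Theorems.TwoPartition
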